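import Summits.CriticalPhenomena.PercolationContinuityZ3.Theorems.PercNearOneGluingNoHeavyQuantRootDecGiantsSmalls
import Summits.CriticalPhenomena.PercolationContinuityZ3.Theorems.PercNearOneGluingNoHeavyQuantDIBStarFloorSplitInduction
import HarnessLib

/-!
# QUANT lane R8, Conjecture DIB\* — the FS step when THE LARGEST BLOB IS SURE is a theorem (lead g18, LEAD-NOTES-G18 N35)

builds on p205010 (kernel theorem, internal audit signed; external expert review pending)

Support file (`--supports stmt-CriticalPhenomena-4575`), QUANT lane lead (gen 18).  Theorems only, no definitions, no sorries, standard
axioms; vocabulary of `…QuantRootReduction` / `…QuantDIBStar` / `…QuantDIBStarFloorSplitInduction`.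

T-DIB ≡ `Quant.IndepBlob.StepLemmaFS` (p259002): a hard instance of Conjecture DIB\* GIVEN the capped row (`RootDec.CappedRows`) of every
one-blob-deleted sub-system.  The lead-g17 proof route FS-E splits on `k` = the largest blob.  THIS FILE PROVES THE STEP WHEN THAT BLOB IS
SURE (`g k = 1`; 'TYPE S' of N35 — 30–60 % of all enumerated hard instances, kit j128353/j129614):

**`Quant.RootDec.stepFS_sure`.**  Floor `1/2 < x < 1`, gates in `[0,1]`, no heavy giant (`x ≤ g i ⟹ a i ≤ j`), no dead light
(`g i < x`, `0 < a i` ⟹ `x² ≤ g i`), discounted credit `Σ_i a i·φ_x(g i) > 2j`, the capped rows of every one-blob deletion, and a SURE blob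
`k` of maximal size ⟹ `x ≤ P(N ≥ j+1)`.  (The light-size, heavy-total and two-lights hypotheses of `StepLemmaFS` are not even needed.)

PROOF (N35 (3)).  `b = a k ≤ j`; `P(N ≥ j+1) = TERM[b, a[k↦0], g, j]` (`term_cond`).  Let `G` = the giants of the rest relative to the
sure part `b` (`j + 1 ≤ b + a i`), `P_G = ∏_G (1 − g)`, `σ = Σ_G φ_x(g i)`.
(A) `G = ∅`: every other blob has size `≤ j − b`, so the CAPPED credit of `a[k↦0]` at floor `x` with sure part `b` is the uncapped one,
`= Σ a φ − b > 2j − b ≥ 2(j − b)`: the inductive row (`CappedRows`) certifies `x` — the only use of the induction hypothesis.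
(B) `σ ≥ x`: the partner lemma (`term_ge_of_giantRates`, p259856): `1 − P_G ≥ x`.
(C) `σ < x`, `P_G ≤ 1 − x`: `term_ge_disj_giants`.
(D) `σ < x`, `P_G > 1 − x`: EXACT giants ⊗ smalls (`term_ge_of_giants_half`, lead g18): with `w⋆ = 1 − (1 − x)/P_G` one has
`P_G (1 − w⋆) = 1 − x`, and `w⋆ ≤ 1/2` because `P_G ≤ 1 − g i₀ ≤ 2(1 − x)` for any giant `i₀` (heavy: `≤ 1 − x`; light: `g ≥ x²`); so the
smalls need only the KERNEL half of DIB\* at floor `w⋆` (`term_ge_of_credit_of_le_half`), whose budget holds because lowering the floor raises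
every credit (`creditAt_mono_floor`) and the giants carried credit `Σ_G a i φ i ≤ b·σ < b` (sizes `≤ b = a k`, rates `≥ 0`), while the rest
had `Σ a φ − b > 2j − b`.
So after this file the FS step is OPEN only when the largest blob has gate `< 1` (types H/L of N35).

NOVELTY.  presearch: as for `…QuantRootDecGiantsSmalls` (none in print).  [this work; this lane's census]; the gluing rows served
[cite: KozmaNitzan2024, Conjecture 3 (p. 15)]; product weights [cite: Grimmett1999, §1.3 p. 10].
-/

namespace Summit.CriticalPhenomena.PercolationContinuityZ3.Theorems

namespace Quant

namespace RootDec

open Finset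

variable {κ : Type} [Fintype κ] [DecidableEq κ]

/-- product-Bernoulli weight of the set `W` of open blobs (as in `…QuantRootReduction`) -/
local notation3 "wt[" g ", " W "]" => ∏ k, (if k ∈ (W : Finset κ) then (g : κ → ℝ) k else 1 - (g : κ → ℝ) k)

/-- the TERM tail `P(s + Σ_{k open} a k ≥ j+1)` (as in `…QuantRootReduction`) -/
local notation3 "TERM[" s ", " a ", " g ", " j "]" =>
  ∑ W : Finset κ, wt[g, W] * (if (j : ℕ) + 1 ≤ (s : ℕ) + ∑ k ∈ W, (a : κ → ℕ) k then (1 : ℝ) else 0)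

/-! ### 1. Credit bookkeeping: lowering the floor raises every blob's (capped) credit -/

/-- The light rate is below the gate: `g < x < 1 ⟹ (g − x²)/(1 − x) ≤ g`. [this work] -/
theorem lightRate_le_gate (x g : ℝ) (hx0 : 0 ≤ x) (hx1 : x < 1) (hgx : g ≤ x) : (g - x ^ 2) / (1 - x) ≤ g := by
  rw [div_le_iff₀ (by linarith)]
  nlinarith [mul_le_mul_of_nonneg_right hgx hx0]

/-- The light rate is decreasing in the floor: `g < w ≤ x < 1 ⟹ (g − x²)/(1 − x) ≤ (g − w²)/(1 − w)`. [this work] -/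
theorem lightRate_mono_floor (x w g : ℝ) (hx0 : 0 ≤ x) (hx1 : x < 1) (hwx : w ≤ x) (hgw : g ≤ w) :
    (g - x ^ 2) / (1 - x) ≤ (g - w ^ 2) / (1 - w) := by
  have h1x : 0 < 1 - x := by linarith
  have h1w : 0 < 1 - w := by linarith
  -- with u = 1 − w ≥ v = 1 − x > 0 and c = 1 − g ≥ u: RHS − LHS = (u − v)(c − uv) ≥ 0
  have hc : 0 ≤ (1 - g) - (1 - w) * (1 - x) := by nlinarith [mul_nonneg h1w.le hx0, sub_nonneg.2 hgw]
  have key : (g - w ^ 2) * (1 - x) - (g - x ^ 2) * (1 - w) = (x - w) * ((1 - g) - (1 - w) * (1 - x)) := by ring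
  rw [div_le_div_iff₀ h1x h1w, ← sub_nonneg, key]
  exact mul_nonneg (sub_nonneg.2 hwx) hc

/-- **Termwise credit monotonicity in the floor** (no dead light): for `w ≤ x < 1`, a blob with `x² ≤ g` if it is light at `x`,
its discounted credit at floor `x`, `a·φ_x(g)`, is at most its CAPPED credit at floor `w` whenever its size is within the cap
(`a ≤ c`): `a·φ_x(g) ≤ (if w ≤ g then a·g else min(a, c)·max(κ_w(g), 0))`. [this work] -/
theorem credit_le_cappedCreditAt (x w g : ℝ) (a c : ℕ) (hx0 : 0 ≤ x) (hx1 : x < 1) (hwx : w ≤ x) (hac : a ≤ c)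
    (hpos : g < x → x ^ 2 ≤ g ∨ a = 0) :
    (a : ℝ) * (if x ≤ g then g else (g - x ^ 2) / (1 - x)) ≤
      (if w ≤ g then (a : ℝ) * g else ((min a c : ℕ) : ℝ) * max ((g - w ^ 2) / (1 - w)) 0) := by
  have ha : (0 : ℝ) ≤ a := Nat.cast_nonneg a
  by_cases hxg : x ≤ g
  · rw [if_pos hxg, if_pos (hwx.trans hxg)]
  · rw [if_neg hxg]
    have hgx : g < x := not_le.1 hxg
    by_cases hwg : w ≤ g
    · rw [if_pos hwg]
      exact mul_le_mul_of_nonneg_left (lightRate_le_gate x g hx0 hx1 hgx.le) ha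
    · rw [if_neg hwg, min_eq_left hac]
      rcases hpos hgx with h | h
      · exact mul_le_mul_of_nonneg_left ((lightRate_mono_floor x w g hx0 hx1 hwx (not_le.1 hwg).le).trans (le_max_left _ _)) ha
      · subst h; simp

/-! ### 2. The FS step when the largest blob is sure -/

/-- **THE FS STEP, TYPE S — the largest blob is SURE (lead g18, N35 (3)).**  Floor `1/2 < x < 1`, gates in `[0,1]`, no heavy giant, no
dead light (`g i < x`, `0 < a i` ⟹ `x² ≤ g i`), discounted credit `> 2j`, the capped rows (`RootDec.CappedRows`) of every one-blob-deleted
sub-system, and a blob `k` with `g k = 1` of maximal size ⟹ `x ≤ P(N ≥ j + 1)`.  See the module docstring for the proof. [this work] -/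
theorem stepFS_sure (a : κ → ℕ) (g : κ → ℝ) (j : ℕ) (x : ℝ) (hx : 1 / 2 < x) (hx1 : x < 1)
    (hg : ∀ i, 0 ≤ g i ∧ g i ≤ 1) (hnogiant : ∀ i, x ≤ g i → a i ≤ j)
    (hpos : ∀ i, g i < x → 0 < a i → x ^ 2 ≤ g i)
    (hcredit : (2 * j : ℝ) < ∑ i, (a i : ℝ) * (if x ≤ g i then g i else (g i - x ^ 2) / (1 - x)))
    (hIH : ∀ i, 0 < a i → CappedRows (Function.update a i 0) g)
    (k : κ) (hk1 : g k = 1) (hmax : ∀ i, a i ≤ a k) :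
    x ≤ ∑ W : Finset κ, wt[g, W] * (if j + 1 ≤ ∑ i ∈ W, a i then (1 : ℝ) else 0) := by
  have hx0 : 0 < x := by linarith
  have h1x : 0 < 1 - x := by linarith
  set φ : κ → ℝ := fun i => if x ≤ g i then g i else (g i - x ^ 2) / (1 - x) with hφ
  set b : ℕ := a k with hb
  set a' : κ → ℕ := Function.update a k 0 with ha'
  have hbj : b ≤ j := hnogiant k (by rw [hk1]; exact hx1.le)
  -- rates are non-negative on non-empty blobs, ≤ 1 everywhere
  have hφ_nonneg : ∀ i, 0 < a i → 0 ≤ φ i := by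
    intro i hi
    simp only [hφ]
    split_ifs with h
    · exact (hg i).1
    · exact div_nonneg (by linarith [hpos i (not_le.1 h) hi]) h1x.le
  have hφ_le_one : ∀ i, φ i ≤ 1 := by
    intro i
    simp only [hφ]
    split_ifs with h
    · exact (hg i).2
    · rw [div_le_one h1x]; nlinarith [not_le.1 h, (hg i).1]
  -- the sure blob is non-empty (else every size is 0 and the credit is 0)
  have hbpos : 0 < b := by
    by_contra h0
    have h0' : ∀ i, a i = 0 := fun i => Nat.eq_zero_of_le_zero ((hmax i).trans (not_lt.1 h0))
    have : ∑ i, (a i : ℝ) * φ i = 0 := Finset.sum_eq_zero fun i _ => by rw [h0' i, Nat.cast_zero, zero_mul]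
    rw [this] at hcredit
    have : (0 : ℝ) ≤ 2 * j := by positivity
    linarith
  -- P(N ≥ j+1) = TERM[b, a', g, j]
  have hsplit : ∑ W : Finset κ, wt[g, W] * (if j + 1 ≤ ∑ i ∈ W, a i then (1 : ℝ) else 0) = TERM[b, a', g, j] := by
    have e := term_cond 0 a g j k
    simp only [zero_add] at e
    rw [e, hk1, sub_self, zero_mul, add_zero, one_mul]
  rw [hsplit]
  -- the credit of the rest
  have ha'k : a' k = 0 := by simp [ha']
  have ha'ne : ∀ i, i ≠ k → a' i = a i := fun i hi => by simp [ha', Function.update_of_ne hi]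
  have ha'le : ∀ i, a' i ≤ b := by
    intro i; by_cases hi : i = k
    · rw [hi, ha'k]; exact Nat.zero_le _
    · rw [ha'ne i hi]; exact hmax i
  have hφk : φ k = 1 := by simp only [hφ]; rw [hk1, if_pos hx1.le]
  have hrest : ∑ i, (a' i : ℝ) * φ i = (∑ i, (a i : ℝ) * φ i) - b := by
    have h1 : ∑ i, (a i : ℝ) * φ i = (a k : ℝ) * φ k + ∑ i ∈ Finset.univ.erase k, (a i : ℝ) * φ i :=
      (Finset.add_sum_erase _ _ (Finset.mem_univ k)).symm
    have h2 : ∑ i, (a' i : ℝ) * φ i = (a' k : ℝ) * φ k + ∑ i ∈ Finset.univ.erase k, (a' i : ℝ) * φ i :=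
      (Finset.add_sum_erase _ _ (Finset.mem_univ k)).symm
    have h3 : ∑ i ∈ Finset.univ.erase k, (a' i : ℝ) * φ i = ∑ i ∈ Finset.univ.erase k, (a i : ℝ) * φ i :=
      Finset.sum_congr rfl fun i hi => by rw [ha'ne i (Finset.ne_of_mem_erase hi)]
    rw [h2, h3, ha'k, Nat.cast_zero, zero_mul, zero_add, h1, hφk, mul_one, hb]
    ring
  -- the giants of the rest, relative to the sure part `b`
  set G : Finset κ := Finset.univ.filter (fun i => j + 1 ≤ b + a' i) with hGdef
  have hG : ∀ i ∈ G, j + 1 ≤ b + a' i := fun i hi => (Finset.mem_filter.1 hi).2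
  have hGpos : ∀ i ∈ G, 0 < a i := by
    intro i hi
    have h := hG i hi
    have hik : i ≠ k := by rintro rfl; rw [ha'k] at h; omega
    rw [ha'ne i hik] at h; omega
  by_cases hGe : G = ∅
  · -- (A) no giant: the inductive row at floor `x` with sure part `b`
    have hsmall : ∀ i, a' i ≤ j - b := by
      intro i
      have : i ∉ G := by rw [hGe]; exact Finset.notMem_empty i
      rw [hGdef, Finset.mem_filter, not_and] at this
      have := this (Finset.mem_univ i)
      omega
    refine hIH k hbpos x b j hx1 ?_
    calc (2 * j : ℝ) < 2 * b + ∑ i, (a' i : ℝ) * φ i := by rw [hrest]; linarith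
      _ ≤ 2 * b + ∑ i, (if x ≤ g i then (a' i : ℝ) * g i
            else ((min (a' i) (j - b) : ℕ) : ℝ) * max ((g i - x ^ 2) / (1 - x)) 0) := by
          refine add_le_add le_rfl (Finset.sum_le_sum fun i _ => ?_)
          refine credit_le_cappedCreditAt x x (g i) (a' i) (j - b) hx0.le hx1 le_rfl (hsmall i) fun hgi => ?_
          by_cases hi : i = k
          · right; rw [hi, ha'k]
          · rw [ha'ne i hi]
            rcases Nat.eq_zero_or_pos (a i) with h0 | hp
            · right; exact h0
            · left; exact hpos i hgi hp
  -- giants exist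
  have hGne : G.Nonempty := Finset.nonempty_iff_ne_empty.2 hGe
  by_cases hσ : x ≤ ∑ i ∈ G, φ i
  · -- (B) the partner lemma
    exact term_ge_of_giantRates b a' g j x hx0 hx1 hg G hG hσ
  have hσ' : ∑ i ∈ G, φ i < x := not_le.1 hσ
  set P : ℝ := ∏ i ∈ G, (1 - g i) with hPdef
  by_cases hPη : P ≤ 1 - x
  · -- (C) disjunction of giants
    have h := term_ge_disj_giants b a' g j hg G hG
    linarith
  -- (D) exact giants ⊗ smalls with the smalls in the kernel half
  have hPη' : 1 - x < P := not_le.1 hPη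
  have hP0 : 0 < P := h1x.trans hPη'
  obtain ⟨i₀, hi₀⟩ := hGne
  have hP2 : P ≤ 2 * (1 - x) := by
    refine (prod_one_sub_le_factor g hg G i₀ hi₀).trans ?_
    by_cases hxi : x ≤ g i₀
    · linarith
    · have := hpos i₀ (not_le.1 hxi) (hGpos i₀ hi₀)
      nlinarith
  set w : ℝ := 1 - (1 - x) / P with hwdef
  have hw : w ≤ 1 / 2 := giants_halfFloor_le_half x P hP0 hP2
  have hwx : w ≤ x := by linarith
  refine term_ge_of_giants_half b a' g j hg G hG x w hw (le_of_eq (giants_halfFloor_eq x P hP0)) ?_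
  -- the budget of the smalls at floor `w`
  have hsmall : ∀ i, i ∉ G → a' i ≤ j - b := by
    intro i hi
    rw [hGdef, Finset.mem_filter, not_and] at hi
    have := hi (Finset.mem_univ i)
    omega
  -- the giants carried credit `< b`
  have hGcredit : ∑ i ∈ G, (a' i : ℝ) * φ i ≤ (b : ℝ) * ∑ i ∈ G, φ i := by
    rw [Finset.mul_sum]
    refine Finset.sum_le_sum fun i hi => mul_le_mul_of_nonneg_right ?_ (hφ_nonneg i (hGpos i hi))
    exact_mod_cast ha'le i
  have hGcredit' : ∑ i ∈ G, (a' i : ℝ) * φ i ≤ b := by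
    have hb0 : (0 : ℝ) ≤ b := Nat.cast_nonneg b
    nlinarith
  -- split the rest's credit into giants and smalls
  have hsplitG : ∑ i, (a' i : ℝ) * φ i = ∑ i ∈ G, (a' i : ℝ) * φ i + ∑ i ∈ Finset.univ.filter (fun i => i ∉ G), (a' i : ℝ) * φ i := by
    rw [← Finset.sum_filter_add_sum_filter_not Finset.univ (fun i => i ∈ G)]
    congr 1
    exact Finset.sum_congr (by ext i; simp) fun _ _ => rfl
  have hsmalls_ge : (2 * ((j : ℝ) - b)) < ∑ i ∈ Finset.univ.filter (fun i => i ∉ G), (a' i : ℝ) * φ i := by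
    have := hrest; rw [hsplitG] at this; linarith
  -- termwise: the smalls' credit at `x` is below their capped credit at `w`; the giants' entries vanish
  calc (2 * j : ℝ) < 2 * b + ∑ i ∈ Finset.univ.filter (fun i => i ∉ G), (a' i : ℝ) * φ i := by linarith
    _ = 2 * b + ∑ i, (((if i ∈ G then 0 else a' i : ℕ)) : ℝ) * φ i := by
        congr 1
        rw [Finset.sum_filter]
        refine Finset.sum_congr rfl fun i _ => ?_
        split_ifs with h <;> simp
    _ ≤ 2 * b + ∑ i, (if w ≤ g i then (((if i ∈ G then 0 else a' i : ℕ)) : ℝ) * g i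
          else ((min (if i ∈ G then 0 else a' i) (j - b) : ℕ) : ℝ) * max ((g i - w ^ 2) / (1 - w)) 0) := by
        refine add_le_add le_rfl (Finset.sum_le_sum fun i _ => ?_)
        refine credit_le_cappedCreditAt x w (g i) _ (j - b) hx0.le hx1 hwx ?_ fun hgi => ?_
        · split_ifs with h
          · exact Nat.zero_le _
          · exact hsmall i h
        · by_cases hiG : i ∈ G
          · right; rw [if_pos hiG]
          · rw [if_neg hiG]
            by_cases hi : i = k
            · right; rw [hi, ha'k]
            · rw [ha'ne i hi]
              rcases Nat.eq_zero_or_pos (a i) with h0 | hp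
              · right; exact h0
              · left; exact hpos i hgi hp

end RootDec

end Quant

end Summit.CriticalPhenomena.PercolationContinuityZ3.Theorems
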